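import Summits.CriticalPhenomena.SAWScalingLimit.Theorems.AnnularMassDecay.Negative.LoadBearing

/-!
# `stub_firstDescentFactorisation`: the first-`A`-descent factorisation of the chain-stopped mass

Line `radial-renewal-kesten-inequality` of the crux `AnnularMassDecay` (stmt-CriticalPhenomena-4729),
stub S4 — the line's lever as a theorem.  For `A > 1`, a centre `z`, a start `u` with
`ρ = dist (Site.toComplex u) z`, a level `s < ρ/A` and a truncation `N`,
`D(u;s)[N] ≤ Σ_{m ≤ N} Σ_η x_c^m · D(u + η m; s)[N] + Skip(u;A,s)[N]`, where `D(u;s)[N]` is the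
`x_c`-mass of the chain-stopped family at level `s` from `u` (an `n`-step self-avoiding walk `ω`,
`0 < n ≤ N`, confined to the open disc of radius `ρ` about `z` after time `0`, whose end is a strict
radial record of radius `≤ s`, and none of whose radial renewal times `0 < t < n` — strict records
whose whole future is strictly closer to `z` — has radius `≤ s`), `η` ranges over the level-`ρ/A`
members of length `m` with end radius `> s`, and `Skip(u;A,s)[N]` is the mass of the level-`ρ/A`
members with end radius `≤ s`; all sums spelled out over `SAW.Zd.saws`, `SAW.criticalFugacity`,
`Site.toComplex`, verbatim as registered in `Cruxes/AnnularMassDecay/Lines/`.  No definitions here.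

Proof.  Cut a level-`s` member `ω` of length `n` at the LEAST radial renewal time `t` of radius
`≤ ρ/A`; if there is none, `ω` is counted by the skip term (`rr_fd_skip_chain`).  Otherwise the
prefix `i ↦ ω (min i t)` is a level-`ρ/A` member of length `t` with end radius `> s`
(`rr_fd_prefix_chain`, `rr_fd_prefix_mem_saws`), the re-based suffix `i ↦ ω (t + min i (n-t)) - ω t`
is a level-`s` member of length `n - t` from `u + ω t` (`rr_fd_suffix_chain`,
`rr_fd_suffix_mem_saws`), the pieces determine `ω` (`rr_fd_cut_injective`; the split of
`SAW.Zd.count_add_le` at the time `t`), and `x_c^t · x_c^{n-t} = x_c^n`; summing the injection over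
nonnegative terms (`rr_fd_abstract_factorisation`) gives the inequality; the membership clauses only
involve the radius profile `i ↦ dist (Site.toComplex (u + ω i)) z` and are proved for real sequences.
Sources: H. Kesten, J. Math. Phys. 4 (1963); N. Madras, G. Slade, *The Self-Avoiding Walk* (1993) §1.2.
-/

noncomputable section

namespace Summit.CriticalPhenomena.SAWScalingLimit.Theorems.AnnularMassDecay.Radial

open scoped BigOperators Classical
open Literature.Probability.LatticeModels Literature.Probability.RandomPlanarGeometry
open Summit.CriticalPhenomena.SAWScalingLimit.Theorems.AnnularMassDecay.Negative (criticalFugacity_pos)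

/-! ### Radius profiles: the three membership facts -/

/-- **Skip case.** A level-`s` member (radius profile `r`, length `n`) with no radial renewal time
`0 < t < n` of radius `≤ L`, where `s ≤ L`, is a level-`L` member with end radius `≤ s`. [folklore] -/
theorem rr_fd_skip_chain {r : ℕ → ℝ} {ρ s L : ℝ} {n : ℕ} (hsL : s ≤ L)
    (hC : 0 < n ∧ (∀ i, 0 < i → i ≤ n → r i < ρ) ∧ (∀ i, i < n → r n < r i) ∧ r n ≤ s ∧
      (∀ t, 0 < t → t < n → (∀ i, i < t → r t < r i) →
        (∀ j, t < j → j ≤ n → r j < r t) → s < r t))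
    (hno : ∀ t, ¬ (0 < t ∧ t < n ∧ (∀ i, i < t → r t < r i) ∧
      (∀ j, t < j → j ≤ n → r j < r t) ∧ r t ≤ L)) :
    r n ≤ s ∧ 0 < n ∧ (∀ i, 0 < i → i ≤ n → r i < ρ) ∧ (∀ i, i < n → r n < r i) ∧ r n ≤ L ∧
      (∀ t, 0 < t → t < n → (∀ i, i < t → r t < r i) →
        (∀ j, t < j → j ≤ n → r j < r t) → L < r t) := by
  obtain ⟨h0, hconf, hend, hns, -⟩ := hC
  refine ⟨hns, h0, hconf, hend, hns.trans hsL, fun t ht0 htn hrec hfut => ?_⟩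
  by_contra hle
  exact hno t ⟨ht0, htn, hrec, hfut, not_lt.1 hle⟩

/-- **Prefix of the cut.** `r`: radius profile of a walk of length `n` confined below `ρ` after time
`0` with no renewal of radius `≤ s` before `n`; `t`: the LEAST radial renewal time `0 < t < n` of
radius `≤ L`.  A profile `r'` agreeing with `r` on `[0, t]` is a level-`L` member of length `t` with
end radius in `(s, L]` (a renewal `t' < t` of the prefix of radius `≤ L` would be one of the whole
walk, as after `t` everything is closer than `r t < r t'`, contradicting minimality). [folklore] -/
theorem rr_fd_prefix_chain {r r' : ℕ → ℝ} {ρ s L : ℝ} {n t : ℕ}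
    (hconf : ∀ i, 0 < i → i ≤ n → r i < ρ)
    (hren : ∀ t', 0 < t' → t' < n → (∀ i, i < t' → r t' < r i) →
      (∀ j, t' < j → j ≤ n → r j < r t') → s < r t')
    (ht0 : 0 < t) (htn : t < n) (hrec : ∀ i, i < t → r t < r i)
    (hfut : ∀ j, t < j → j ≤ n → r j < r t) (hL : r t ≤ L)
    (hmin : ∀ t', t' < t → ¬ (0 < t' ∧ t' < n ∧ (∀ i, i < t' → r t' < r i) ∧
      (∀ j, t' < j → j ≤ n → r j < r t') ∧ r t' ≤ L))
    (hr' : ∀ i, i ≤ t → r' i = r i) :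
    s < r' t ∧ 0 < t ∧ (∀ i, 0 < i → i ≤ t → r' i < ρ) ∧ (∀ i, i < t → r' t < r' i) ∧
      r' t ≤ L ∧
      (∀ t', 0 < t' → t' < t → (∀ i, i < t' → r' t' < r' i) →
        (∀ j, t' < j → j ≤ t → r' j < r' t') → L < r' t') := by
  have hrt : r' t = r t := hr' t le_rfl
  refine ⟨?_, ht0, ?_, ?_, ?_, ?_⟩
  · exact hrt ▸ hren t ht0 htn hrec hfut
  · intro i hi hit
    rw [hr' i hit]
    exact hconf i hi (hit.trans htn.le)
  · intro i hit
    rw [hrt, hr' i hit.le]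
    exact hrec i hit
  · exact hrt ▸ hL
  · intro t' h0 ht't hrec' hfut'
    by_contra hle
    have hrt' : r' t' = r t' := hr' t' ht't.le
    refine hmin t' ht't ⟨h0, ht't.trans htn, ?_, ?_, ?_⟩
    · intro i hi
      rw [← hrt', ← hr' i (hi.le.trans ht't.le)]
      exact hrec' i hi
    · intro j htj hjn
      rcases le_or_gt j t with hjt | hjt
      · rw [← hrt', ← hr' j hjt]
        exact hfut' j htj hjt
      · have h2 : r' t < r' t' := hfut' t ht't le_rfl
        rw [hrt, hrt'] at h2
        exact (hfut j hjt hjn).trans h2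
    · exact hrt' ▸ not_lt.1 hle

/-- **Suffix of the cut.** `r`: radius profile of a level-`s` member of length `n`; `t < n` a radial
renewal time.  A profile `r''` with `r'' i = r (t + i)` on `[0, n - t]` is a level-`s` member of
length `n - t` about the base radius `ρw = r t` (a renewal `t'` of the suffix is the renewal `t + t'`
of the whole walk, times `≤ t` being farther than `r t > r (t + t')`, so its radius is `> s`).
[folklore] -/
theorem rr_fd_suffix_chain {r r'' : ℕ → ℝ} {s ρw : ℝ} {n t : ℕ}
    (hend : ∀ i, i < n → r n < r i) (hns : r n ≤ s)
    (hren : ∀ t', 0 < t' → t' < n → (∀ i, i < t' → r t' < r i) →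
      (∀ j, t' < j → j ≤ n → r j < r t') → s < r t')
    (htn : t < n) (hrec : ∀ i, i < t → r t < r i)
    (hfut : ∀ j, t < j → j ≤ n → r j < r t) (hρw : ρw = r t)
    (hr'' : ∀ i, i ≤ n - t → r'' i = r (t + i)) :
    0 < n - t ∧ (∀ i, 0 < i → i ≤ n - t → r'' i < ρw) ∧
      (∀ i, i < n - t → r'' (n - t) < r'' i) ∧ r'' (n - t) ≤ s ∧
      (∀ t', 0 < t' → t' < n - t → (∀ i, i < t' → r'' t' < r'' i) →
        (∀ j, t' < j → j ≤ n - t → r'' j < r'' t') → s < r'' t') := by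
  have hm : r'' (n - t) = r n := by rw [hr'' _ le_rfl, Nat.add_sub_of_le htn.le]
  refine ⟨Nat.sub_pos_of_lt htn, ?_, ?_, ?_, ?_⟩
  · intro i hi him
    rw [hr'' i him, hρw]
    exact hfut (t + i) (by omega) (by omega)
  · intro i him
    rw [hm, hr'' i him.le]
    exact hend (t + i) (by omega)
  · exact hm ▸ hns
  · intro t' h0 ht' hrec' hfut'
    rw [hr'' t' ht'.le]
    refine hren (t + t') (by omega) (by omega) ?_ ?_
    · intro i hi
      rcases lt_or_ge i t with hit | hit
      · exact (hfut (t + t') (by omega) (by omega)).trans (hrec i hit)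
      · obtain ⟨k, rfl⟩ : ∃ k, i = t + k := ⟨i - t, by omega⟩
        have h := hrec' k (by omega)
        rwa [hr'' t' ht'.le, hr'' k (by omega)] at h
    · intro j htj hjn
      obtain ⟨k, rfl⟩ : ∃ k, j = t + k := ⟨j - t, by omega⟩
      have h := hfut' k (by omega) (by omega)
      rwa [hr'' k (by omega), hr'' t' ht'.le] at h

/-! ### Walks: the two pieces are self-avoiding walks from `0` and determine the walk -/

/-- The first `t ≤ n` steps of an `n`-step self-avoiding walk from `0` form a `t`-step self-avoiding
walk from `0` (frozen from time `t` on). [folklore] -/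
theorem rr_fd_prefix_mem_saws {n t : ℕ} {ω : ℕ → Site 2} (hω : ω ∈ SAW.Zd.saws 2 n) (ht : t ≤ n) :
    (fun i => ω (min i t)) ∈ SAW.Zd.saws 2 t := by
  -- adapted from the proof of `SAW.Zd.count_add_le` (Literature/…/SAWCount.lean)
  rw [SAW.Zd.mem_saws] at hω ⊢
  obtain ⟨h0, -, hadj, hinj⟩ := hω
  refine ⟨by simpa using h0, fun i hi => by simp [min_eq_right hi], ?_, ?_⟩
  · intro i hi
    have h1 : min i t = i := min_eq_left hi.le
    have h2 : min (i + 1) t = i + 1 := min_eq_left (by omega)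
    simp only [h1, h2]
    exact hadj i (by omega)
  · intro i hi j hj hij
    simp only [Set.mem_setOf_eq] at hi hj
    simp only [min_eq_left hi, min_eq_left hj] at hij
    exact hinj (by simp only [Set.mem_setOf_eq]; omega)
      (by simp only [Set.mem_setOf_eq]; omega) hij

/-- The last `n - t` steps of an `n`-step self-avoiding walk from `0`, re-based at `ω t`, form an
`(n - t)`-step self-avoiding walk from `0`. [folklore] -/
theorem rr_fd_suffix_mem_saws {n t : ℕ} {ω : ℕ → Site 2} (hω : ω ∈ SAW.Zd.saws 2 n) (ht : t ≤ n) :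
    (fun i => ω (t + min i (n - t)) - ω t) ∈ SAW.Zd.saws 2 (n - t) := by
  -- adapted from the proof of `SAW.Zd.count_add_le` (Literature/…/SAWCount.lean)
  rw [SAW.Zd.mem_saws] at hω ⊢
  obtain ⟨-, hend, hadj, hinj⟩ := hω
  refine ⟨by simp, fun i hi => by simp [min_eq_right hi], ?_, ?_⟩
  · intro i hi
    have h1 : min i (n - t) = i := min_eq_left hi.le
    have h2 : min (i + 1) (n - t) = i + 1 := min_eq_left (by omega)
    simp only [h1, h2]
    rw [SAW.Zd.zdGraph_adj_sub_right, ← add_assoc]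
    exact hadj (t + i) (by omega)
  · intro i hi j hj hij
    simp only [Set.mem_setOf_eq] at hi hj
    simp only [min_eq_left hi, min_eq_left hj, sub_left_inj] at hij
    have h := hinj (by simp only [Set.mem_setOf_eq]; omega)
      (by simp only [Set.mem_setOf_eq]; omega) hij
    omega

/-- **Reconstruction.** An `n`-step walk (frozen after `n`) is determined by its first `t` steps,
the number `n - t` and its re-based last `n - t` steps: the cut map is injective. [folklore] -/
theorem rr_fd_cut_injective {t n n' : ℕ} {ω ω' : ℕ → Site 2} (hω : ω ∈ SAW.Zd.saws 2 n)
    (hω' : ω' ∈ SAW.Zd.saws 2 n') (htn : t ≤ n) (htn' : t ≤ n')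
    (h1 : (fun i => ω (min i t)) = fun i => ω' (min i t)) (h2 : n - t = n' - t)
    (h3 : (fun i => ω (t + min i (n - t)) - ω t) = fun i => ω' (t + min i (n' - t)) - ω' t) :
    n = n' ∧ ω = ω' := by
  -- adapted from the proof of `SAW.Zd.count_add_le` (Literature/…/SAWCount.lean)
  obtain rfl : n = n' := by omega
  refine ⟨rfl, ?_⟩
  rw [SAW.Zd.mem_saws] at hω hω'
  have ht : ω t = ω' t := by simpa using congrFun h1 t
  funext i
  rcases le_or_gt i t with hi | hi
  · simpa [min_eq_left hi] using congrFun h1 i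
  · obtain ⟨k, rfl⟩ : ∃ k, i = t + k := ⟨i - t, by omega⟩
    rcases le_or_gt k (n - t) with hk | hk
    · have h := congrFun h3 k
      simp only [min_eq_left hk] at h
      rwa [ht, sub_left_inj] at h
    · have h := congrFun h3 (n - t)
      simp only [min_self] at h
      rw [ht, sub_left_inj, Nat.add_sub_of_le htn] at h
      rw [hω.2.1 (t + k) (by omega), hω'.2.1 (t + k) (by omega), h]

/-! ### Finite-sum bookkeeping -/

/-- Transport of a sum along a map injective on the source into a sum of nonnegative terms
dominating it pointwise. [folklore] -/
theorem rr_fd_sum_le_sum_of_injOn {ι κ : Type*} [DecidableEq κ] {s : Finset ι} {t : Finset κ}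
    (e : ι → κ) {f : ι → ℝ} {g : κ → ℝ} (he : Set.InjOn e s) (hst : ∀ i ∈ s, e i ∈ t)
    (hg : ∀ j ∈ t, 0 ≤ g j) (hfg : ∀ i ∈ s, f i ≤ g (e i)) :
    ∑ i ∈ s, f i ≤ ∑ j ∈ t, g j := by
  calc ∑ i ∈ s, f i ≤ ∑ i ∈ s, g (e i) := Finset.sum_le_sum hfg
    _ = ∑ j ∈ s.image e, g j := (Finset.sum_image he).symm
    _ ≤ ∑ j ∈ t, g j :=
        Finset.sum_le_sum_of_subset_of_nonneg (Finset.image_subset_iff.mpr hst) fun j hj _ => hg j hj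

/-- **Abstract first-descent factorisation.**  `S n` are finite sets ("walks of length `n`"), `C`,
`K`, `P` predicates on `(n, ω)` (level-`s` member, skipping member, admissible prefix), `C' m η k σ`
a predicate on suffixes relative to a prefix, `Good n ω t` the admissible cut times, `pre`/`suf` the
two pieces of the cut at time `t`.  If every `C`-member without an admissible cut time is a
`K`-member (`hskip`), the cut at the least admissible time `t` yields a `P`-prefix of length `t ≤ n`
and a `C'`-suffix of length `n - t` (`hcut`), and the pieces with `t` determine `(n, ω)` (`hinj`),
then the `x^n`-weighted count of `C`-members (`n ≤ N`, `0 ≤ x`) is at most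
`Σ_{P-prefixes} x^m · Σ_{C'-suffixes} x^k` plus the weighted count of `K`-members. [folklore] -/
theorem rr_fd_abstract_factorisation {α : Type*} {x : ℝ} (hx : 0 ≤ x) (N : ℕ) (S : ℕ → Finset α)
    (C K P : ℕ → α → Prop) (C' : ℕ → α → ℕ → α → Prop) (Good : ℕ → α → ℕ → Prop)
    {instC : ∀ n, DecidablePred (C n)} {instK : ∀ n, DecidablePred (K n)}
    {instP : ∀ n, DecidablePred (P n)} {instC' : ∀ m η k, DecidablePred (C' m η k)}
    (pre suf : ℕ → α → ℕ → α)
    (hskip : ∀ n ω, ω ∈ S n → C n ω → (∀ t, ¬ Good n ω t) → K n ω)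
    (hcut : ∀ n ω t, ω ∈ S n → C n ω → Good n ω t → (∀ t', t' < t → ¬ Good n ω t') →
      t ≤ n ∧ pre n ω t ∈ S t ∧ P t (pre n ω t) ∧ suf n ω t ∈ S (n - t) ∧
        C' t (pre n ω t) (n - t) (suf n ω t))
    (hinj : ∀ t n ω n' ω', ω ∈ S n → ω' ∈ S n' → t ≤ n → t ≤ n' →
      pre n ω t = pre n' ω' t → n - t = n' - t → suf n ω t = suf n' ω' t → n = n' ∧ ω = ω') :
    ∑ n ∈ Finset.range (N + 1), ∑ _ω ∈ (S n).filter (C n), x ^ n ≤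
      (∑ m ∈ Finset.range (N + 1), ∑ η ∈ (S m).filter (P m),
          x ^ m * (∑ k ∈ Finset.range (N + 1), ∑ _σ ∈ (S k).filter (C' m η k), x ^ k)) +
      ∑ n ∈ Finset.range (N + 1), ∑ _ω ∈ (S n).filter (K n), x ^ n := by
  classical
  have eL : ∑ n ∈ Finset.range (N + 1), ∑ _ω ∈ (S n).filter (C n), x ^ n =
      ∑ p ∈ (Finset.range (N + 1)).sigma (fun n => (S n).filter (C n)), x ^ p.1 :=
    Finset.sum_sigma' _ _ fun n _ => x ^ n
  have eK : ∑ n ∈ Finset.range (N + 1), ∑ _ω ∈ (S n).filter (K n), x ^ n =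
      ∑ p ∈ (Finset.range (N + 1)).sigma (fun n => (S n).filter (K n)), x ^ p.1 :=
    Finset.sum_sigma' _ _ fun n _ => x ^ n
  have eP : (∑ m ∈ Finset.range (N + 1), ∑ η ∈ (S m).filter (P m),
        x ^ m * (∑ k ∈ Finset.range (N + 1), ∑ _σ ∈ (S k).filter (C' m η k), x ^ k)) =
      ∑ y ∈ ((Finset.range (N + 1)).sigma (fun m => (S m).filter (P m))).sigma
          (fun q => (Finset.range (N + 1)).sigma (fun k => (S k).filter (C' q.1 q.2 k))),
        x ^ y.1.1 * x ^ y.2.1 := by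
    rw [Finset.sum_sigma, Finset.sum_sigma]
    refine Finset.sum_congr rfl fun m _ => Finset.sum_congr rfl fun η _ => ?_
    rw [Finset.mul_sum, Finset.sum_sigma]
    refine Finset.sum_congr rfl fun k _ => ?_
    rw [Finset.mul_sum]
  have esplit := Finset.sum_filter_add_sum_filter_not
    ((Finset.range (N + 1)).sigma (fun n => (S n).filter (C n)))
    (fun p => ∃ t, Good p.1 p.2 t) (fun p => x ^ p.1)
  rw [eL, eK, eP, ← esplit]
  refine add_le_add ?_ ?_
  · -- the cut part: inject into (prefix, suffix) pairs, cutting at the least admissible time `T p`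
    set T : (Σ _ : ℕ, α) → ℕ := fun p => if h : ∃ t, Good p.1 p.2 t then Nat.find h else 0
      with hTdef
    have hT : ∀ p ∈ ((Finset.range (N + 1)).sigma (fun n => (S n).filter (C n))).filter
        (fun p => ∃ t, Good p.1 p.2 t),
        p.1 < N + 1 ∧ p.2 ∈ S p.1 ∧ T p ≤ p.1 ∧ pre p.1 p.2 (T p) ∈ S (T p) ∧
          P (T p) (pre p.1 p.2 (T p)) ∧ suf p.1 p.2 (T p) ∈ S (p.1 - T p) ∧
          C' (T p) (pre p.1 p.2 (T p)) (p.1 - T p) (suf p.1 p.2 (T p)) := by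
      intro p hp
      simp only [Finset.mem_filter, Finset.mem_sigma, Finset.mem_range] at hp
      obtain ⟨⟨hn, hS, hC⟩, hex⟩ := hp
      have hTp : T p = Nat.find hex := by rw [hTdef]; exact dif_pos hex
      rw [hTp]
      exact ⟨hn, hS, hcut p.1 p.2 _ hS hC (Nat.find_spec hex) fun t' ht' => Nat.find_min hex ht'⟩
    refine rr_fd_sum_le_sum_of_injOn
      (fun p => (⟨⟨T p, pre p.1 p.2 (T p)⟩, ⟨p.1 - T p, suf p.1 p.2 (T p)⟩⟩ :
        Σ _ : (Σ _ : ℕ, α), (Σ _ : ℕ, α))) ?_ ?_ ?_ ?_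
    · -- injective
      intro p hp p' hp' hpp'
      obtain ⟨-, hS, hTn, -⟩ := hT p hp
      obtain ⟨-, hS', hTn', -⟩ := hT p' hp'
      simp only [Sigma.mk.injEq, heq_eq_eq] at hpp'
      obtain ⟨⟨hTT, hpre⟩, hsub, hsuf⟩ := hpp'
      rw [← hTT] at hpre hsub hsuf hTn'
      obtain ⟨n, ω⟩ := p
      obtain ⟨n', ω'⟩ := p'
      obtain ⟨rfl, rfl⟩ := hinj _ n ω n' ω' hS hS' hTn hTn' hpre hsub hsuf
      rfl
    · -- lands in the (prefix, suffix) pairs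
      intro p hp
      obtain ⟨hn, -, hTn, hpre, hP, hsuf, hC'⟩ := hT p hp
      simp only [Finset.mem_sigma, Finset.mem_filter, Finset.mem_range]
      exact ⟨⟨by omega, hpre, hP⟩, by omega, hsuf, hC'⟩
    · -- nonnegative terms
      exact fun y _ => mul_nonneg (pow_nonneg hx _) (pow_nonneg hx _)
    · -- weights multiply
      intro p hp
      obtain ⟨-, -, hTn, -⟩ := hT p hp
      show x ^ p.1 ≤ x ^ T p * x ^ (p.1 - T p)
      rw [← pow_add, Nat.add_sub_of_le hTn]
  · -- the skip part: a sub-family of the skipping members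
    refine Finset.sum_le_sum_of_subset_of_nonneg ?_ fun p _ _ => pow_nonneg hx _
    intro p hp
    simp only [Finset.mem_filter, Finset.mem_sigma, not_exists] at hp ⊢
    exact ⟨hp.1.1, hp.1.2.1, hskip p.1 p.2 hp.1.2.1 hp.1.2.2 hp.2⟩

/-! ### The stub -/

/-- **S4 · `stub_firstDescentFactorisation`** — the exact first-`A`-descent renewal cut of the line
`radial-renewal-kesten-inequality` (crux `AnnularMassDecay`, stmt-CriticalPhenomena-4729), registered
verbatim in `Cruxes/AnnularMassDecay/Lines/radial-renewal-kesten-inequality.lean`: for `A > 1`, `z`,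
`u`, `s < dist (Site.toComplex u) z / A` and `N`, `D(u;s)[N] ≤ Σ_η x_c^{|η|} D(u + η_m; s)[N] +
Skip(u;A,s)[N]`.  Proof: `rr_fd_abstract_factorisation` fed with the cut at the least radial renewal
time of radius `≤ dist (Site.toComplex u) z / A` (`rr_fd_skip_chain`, `rr_fd_prefix_chain`,
`rr_fd_suffix_chain`, `rr_fd_prefix_mem_saws`, `rr_fd_suffix_mem_saws`, `rr_fd_cut_injective`). -/
theorem stub_firstDescentFactorisation :
    ∀ A : ℝ, 1 < A → ∀ (z : ℂ) (u : Site 2) (s : ℝ), s < dist (Site.toComplex u) z / A → ∀ N : ℕ,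
      (∑ n ∈ Finset.range (N + 1),
        ∑ _ω ∈ (SAW.Zd.saws 2 n).filter (fun ω =>
          0 < n ∧
          (∀ i, 0 < i → i ≤ n → dist (Site.toComplex (u + ω i)) z < dist (Site.toComplex u) z) ∧
          (∀ i, i < n → dist (Site.toComplex (u + ω n)) z < dist (Site.toComplex (u + ω i)) z) ∧
          dist (Site.toComplex (u + ω n)) z ≤ s ∧
          (∀ t, 0 < t → t < n →
            (∀ i, i < t → dist (Site.toComplex (u + ω t)) z < dist (Site.toComplex (u + ω i)) z) →
            (∀ j, t < j → j ≤ n → dist (Site.toComplex (u + ω j)) z < dist (Site.toComplex (u + ω t)) z) →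
            s < dist (Site.toComplex (u + ω t)) z)),
          SAW.criticalFugacity ^ n) ≤
      (∑ m ∈ Finset.range (N + 1),
        ∑ η ∈ (SAW.Zd.saws 2 m).filter (fun η =>
            s < dist (Site.toComplex (u + η m)) z ∧
            0 < m ∧
            (∀ i, 0 < i → i ≤ m → dist (Site.toComplex (u + η i)) z < dist (Site.toComplex u) z) ∧
            (∀ i, i < m → dist (Site.toComplex (u + η m)) z < dist (Site.toComplex (u + η i)) z) ∧
            dist (Site.toComplex (u + η m)) z ≤ dist (Site.toComplex u) z / A ∧
            (∀ t, 0 < t → t < m →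
              (∀ i, i < t → dist (Site.toComplex (u + η t)) z < dist (Site.toComplex (u + η i)) z) →
              (∀ j, t < j → j ≤ m → dist (Site.toComplex (u + η j)) z < dist (Site.toComplex (u + η t)) z) →
              dist (Site.toComplex u) z / A < dist (Site.toComplex (u + η t)) z)),
          SAW.criticalFugacity ^ m *
            (∑ n ∈ Finset.range (N + 1),
                ∑ _ω ∈ (SAW.Zd.saws 2 n).filter (fun ω =>
                  0 < n ∧
                  (∀ i, 0 < i → i ≤ n → dist (Site.toComplex (u + η m + ω i)) z < dist (Site.toComplex (u + η m)) z) ∧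
                  (∀ i, i < n → dist (Site.toComplex (u + η m + ω n)) z < dist (Site.toComplex (u + η m + ω i)) z) ∧
                  dist (Site.toComplex (u + η m + ω n)) z ≤ s ∧
                  (∀ t, 0 < t → t < n →
                    (∀ i, i < t → dist (Site.toComplex (u + η m + ω t)) z < dist (Site.toComplex (u + η m + ω i)) z) →
                    (∀ j, t < j → j ≤ n → dist (Site.toComplex (u + η m + ω j)) z < dist (Site.toComplex (u + η m + ω t)) z) →
                    s < dist (Site.toComplex (u + η m + ω t)) z)),
                  SAW.criticalFugacity ^ n)) +
      (∑ n ∈ Finset.range (N + 1),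
        ∑ _ω ∈ (SAW.Zd.saws 2 n).filter (fun ω =>
          dist (Site.toComplex (u + ω n)) z ≤ s ∧
          0 < n ∧
          (∀ i, 0 < i → i ≤ n → dist (Site.toComplex (u + ω i)) z < dist (Site.toComplex u) z) ∧
          (∀ i, i < n → dist (Site.toComplex (u + ω n)) z < dist (Site.toComplex (u + ω i)) z) ∧
          dist (Site.toComplex (u + ω n)) z ≤ dist (Site.toComplex u) z / A ∧
          (∀ t, 0 < t → t < n →
            (∀ i, i < t → dist (Site.toComplex (u + ω t)) z < dist (Site.toComplex (u + ω i)) z) →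
            (∀ j, t < j → j ≤ n → dist (Site.toComplex (u + ω j)) z < dist (Site.toComplex (u + ω t)) z) →
            dist (Site.toComplex u) z / A < dist (Site.toComplex (u + ω t)) z)),
          SAW.criticalFugacity ^ n) := by
  intro A _ z u s hs N
  refine rr_fd_abstract_factorisation (α := ℕ → Site 2) criticalFugacity_pos.le N (SAW.Zd.saws 2)
    _ _ _ _
    (fun n ω t => 0 < t ∧ t < n ∧
      (∀ i, i < t → dist (Site.toComplex (u + ω t)) z < dist (Site.toComplex (u + ω i)) z) ∧
      (∀ j, t < j → j ≤ n → dist (Site.toComplex (u + ω j)) z < dist (Site.toComplex (u + ω t)) z) ∧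
      dist (Site.toComplex (u + ω t)) z ≤ dist (Site.toComplex u) z / A)
    (fun _ ω t => fun i => ω (min i t)) (fun n ω t => fun i => ω (t + min i (n - t)) - ω t)
    ?_ ?_ ?_
  · -- skip case
    intro n ω _ hC hno
    exact rr_fd_skip_chain (r := fun k => dist (Site.toComplex (u + ω k)) z) hs.le hC hno
  · -- cut case
    intro n ω t hω hC hgood hmin
    obtain ⟨_, hconf, hend, hns, hren⟩ := hC
    obtain ⟨ht0, htn, hrec, hfut, hL⟩ := hgood
    refine ⟨htn.le, rr_fd_prefix_mem_saws hω htn.le, ?_, rr_fd_suffix_mem_saws hω htn.le, ?_⟩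
    · exact rr_fd_prefix_chain (r := fun k => dist (Site.toComplex (u + ω k)) z)
        (r' := fun i => dist (Site.toComplex (u + ω (min i t))) z)
        hconf hren ht0 htn hrec hfut hL hmin (fun i hi => by simp only [min_eq_left hi])
    · exact rr_fd_suffix_chain (r := fun k => dist (Site.toComplex (u + ω k)) z)
        (r'' := fun i =>
          dist (Site.toComplex (u + ω (min t t) + (ω (t + min i (n - t)) - ω t))) z)
        (ρw := dist (Site.toComplex (u + ω (min t t))) z)
        hend hns hren htn hrec hfut (by simp only [min_self])
        (fun i hi => by simp only [min_self, min_eq_left hi, add_add_sub_cancel])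
  · -- injectivity of the cut
    exact fun t n ω n' ω' hω hω' htn htn' h1 h2 h3 => rr_fd_cut_injective hω hω' htn htn' h1 h2 h3

end Summit.CriticalPhenomena.SAWScalingLimit.Theorems.AnnularMassDecay.Radial

end
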